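import Summits.CriticalPhenomena.PercolationContinuityZ3.Theses.PercNearOneGluing
import Summits.CriticalPhenomena.PercolationContinuityZ3.Theorems.PercNearOneGluingAdditiveGluingTOfTD
import HarnessLib

/-!
# Crux `PercNearOneGluing.AdditiveGluing` (stmt-CriticalPhenomena-4576), line `tieline`: the Phi-transfer (Φ_D) from (T_D)

Support file (`--supports stmt-CriticalPhenomena-4576`, helper, lead c14).  No definitions, no named facts, no sorries.

Relays `u, v`, target `b`, observer `o`, spectator `c`; `μ = prodBernoulli w`, `D = {u ↮ v}`, `N = {c ↮ u} ∩ {c ↮ v}`,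
`J = {o ↔ c}`; `m₁ = μ(D ∩ vb)`, `m₂ = μ(D ∩ ub)`, `P_x = μ(D ∩ vb ∩ {x ↮ u})`, `Q_x = μ(D ∩ ub ∩ {v ↔ x})`.
The registered stub `stub_phiTransfer_c14` is
  (Φ_D)  `μ(D∩N∩J)·(m₂·P_c − m₁·Q_c) ≤ μ(D∩N)·(m₂·P_o − m₁·Q_o)`.
This file derives it from the all-conditional kernel (T_D) (= `stub_kernelTD_c13`),
  (T_D)  `μ(D)·(μ(D∩ub∩vo)·μ(D∩N) − μ(D∩ub∩vc)·μ(D∩N∩J)) ≤ μ(D∩ub)·(μ(D∩vo)·μ(D∩N) − μ(D∩vc)·μ(D∩N∩J))`,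
applied at `(o, b, u, v, c)` and, with the two relays swapped, at `(o, b, v, u, c)`.  Writing `sTD, sTD' ≥ 0` for the
slacks of these two instances and `slackΦ` for the slack of (Φ_D), one has the exact identity
  `μ(D)·slackΦ = m₁·sTD + m₂·sTD' + m₁·m₂·μ(D∩N)·(μ(D ∩ {v ↮ o} ∩ {u ↮ o}) − μ(D∩N∩J))`,
which uses only the partitions `D = (D∩vo) ⊔ (D∩uo) ⊔ (D, o free)`, `D = (D∩vc) ⊔ (D∩uc) ⊔ (D∩N)`,
`D∩vb = (D∩vb∩uo) ⊔ (D∩vb∩{o ↮ u})` (same with `c`); its last term is `≥ 0` because `D∩N∩J ⊆ (D, o free)`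
(if `o ↔ c` and `c` is joined to neither relay then neither is `o`).  If `μ(D) = 0` everything vanishes.
[cite: KozmaNitzan2024, Question 7 (p. 36)]
-/

namespace Summit.CriticalPhenomena.PercolationContinuityZ3.Cruxes.AdditiveGluing.TieLine

open MeasureTheory Set Literature.Probability.LatticeModels Literature.Probability.Percolation

noncomputable section

namespace PhiOfTD

variable {n : ℕ}

/-- On `D = {u ↮ v}` a vertex joined to `u` is not joined to `v`: `(D \ {v ↔ x}) ∩ {u ↔ x} = D ∩ {u ↔ x}`. [folklore] -/
theorem D_diff_inter (u v x : Fin n) :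
    (((openConn u v)ᶜ \ openConn v x) ∩ openConn u x : Set (BondConfig (Fin n))) =
      (openConn u v)ᶜ ∩ openConn u x := by
  ext ω
  simp only [mem_inter_iff, mem_sdiff, mem_compl_iff, openConn, mem_setOf_eq]
  constructor
  · rintro ⟨⟨hD, -⟩, hux⟩
    exact ⟨hD, hux⟩
  · rintro ⟨hD, hux⟩
    exact ⟨⟨hD, fun hvx => hD (hux.trans hvx.symm)⟩, hux⟩

/-- On `D = {u ↮ v}`: `(D \ {v ↔ c}) \ {u ↔ c} = D ∩ ({c ↮ u} ∩ {c ↮ v})`. [folklore] -/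
theorem D_diff_diff (u v c : Fin n) :
    (((openConn u v)ᶜ \ openConn v c) \ openConn u c : Set (BondConfig (Fin n))) =
      (openConn u v)ᶜ ∩ ((openConn c u)ᶜ ∩ (openConn c v)ᶜ) := by
  ext ω
  simp only [mem_inter_iff, mem_sdiff, mem_compl_iff, openConn, mem_setOf_eq]
  constructor
  · rintro ⟨⟨hD, hvc⟩, huc⟩
    exact ⟨hD, fun h => huc h.symm, fun h => hvc h.symm⟩
  · rintro ⟨hD, hcu, hcv⟩
    exact ⟨⟨hD, fun h => hcv h.symm⟩, fun h => hcu h.symm⟩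

/-- `D ∩ N ∩ {o ↔ c} ⊆ (D \ {v ↔ o}) \ {u ↔ o}`: if `o ↔ c` and `c` is joined to neither relay, neither is `o`.
[folklore] -/
theorem DNJ_subset (o u v c : Fin n) :
    ((openConn u v)ᶜ ∩ ((openConn c u)ᶜ ∩ (openConn c v)ᶜ) ∩ openConn o c : Set (BondConfig (Fin n))) ⊆
      ((openConn u v)ᶜ \ openConn v o) \ openConn u o := by
  intro ω
  simp only [mem_inter_iff, mem_sdiff, mem_compl_iff, openConn, mem_setOf_eq]
  rintro ⟨⟨hD, hcu, hcv⟩, hoc⟩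
  exact ⟨⟨hD, fun hvo => hcv (hvo.trans hoc).symm⟩, fun huo => hcu (huo.trans hoc).symm⟩

/-- Three-way partition of `D = {u ↮ v}` according to `x`:
`μ(D) = μ(D ∩ {v ↔ x}) + μ(D ∩ {u ↔ x}) + μ((D \ {v ↔ x}) \ {u ↔ x})`. [folklore] -/
theorem real_D_split (w : Sym2 (Fin n) → unitInterval) (u v x : Fin n) :
    (prodBernoulli w).real ((openConn u v)ᶜ : Set (BondConfig (Fin n))) =
      (prodBernoulli w).real ((openConn u v)ᶜ ∩ openConn v x : Set (BondConfig (Fin n))) +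
          (prodBernoulli w).real ((openConn u v)ᶜ ∩ openConn u x : Set (BondConfig (Fin n))) +
        (prodBernoulli w).real (((openConn u v)ᶜ \ openConn v x) \ openConn u x : Set (BondConfig (Fin n))) := by
  have h1 := measureReal_inter_add_sdiff (μ := prodBernoulli w) (s := ((openConn u v)ᶜ : Set (BondConfig (Fin n))))
    (t := (openConn v x : Set (BondConfig (Fin n)))) (Set.toFinite _).measurableSet
  have h2 := measureReal_inter_add_sdiff (μ := prodBernoulli w)
    (s := ((openConn u v)ᶜ \ openConn v x : Set (BondConfig (Fin n)))) (t := (openConn u x : Set (BondConfig (Fin n))))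
    (Set.toFinite _).measurableSet
  rw [D_diff_inter] at h2
  linarith

/-- Two-way partition of `D ∩ {v ↔ b}` according to `{u ↔ x}`:
`μ(D ∩ vb) = μ(D ∩ vb ∩ {u ↔ x}) + μ(D ∩ vb ∩ {x ↮ u})`. [folklore] -/
theorem real_Dvb_split (w : Sym2 (Fin n) → unitInterval) (b u v x : Fin n) :
    (prodBernoulli w).real ((openConn u v)ᶜ ∩ openConn v b : Set (BondConfig (Fin n))) =
      (prodBernoulli w).real ((openConn u v)ᶜ ∩ openConn v b ∩ openConn u x : Set (BondConfig (Fin n))) +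
        (prodBernoulli w).real ((openConn u v)ᶜ ∩ openConn v b ∩ (openConn x u)ᶜ : Set (BondConfig (Fin n))) := by
  have h := measureReal_inter_add_sdiff (μ := prodBernoulli w)
    (s := ((openConn u v)ᶜ ∩ openConn v b : Set (BondConfig (Fin n)))) (t := (openConn u x : Set (BondConfig (Fin n))))
    (Set.toFinite _).measurableSet
  rw [KNPreFKG.openConn_symm x u, ← sdiff_eq]
  exact h.symm

/-- The real algebra behind (Φ_D) ⟸ (T_D): with the slacks of the two instances `hA, hB` of (T_D), the partitions
`d = dvo + duo + Dof = dvc + duc + DN`, `m₁ = dvbuo + Po = dvbuc + Pc` and `DNJ ≤ Dof`, the identity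
`d·slackΦ = m₁·sTD + m₂·sTD' + m₁·m₂·DN·(Dof − DNJ)` gives `slackΦ ≥ 0` (and everything vanishes if `d = 0`). [folklore] -/
theorem alg {d m₁ m₂ DN DNJ Po Pc Qo Qc dvo dvc duo duc dvbuo dvbuc Dof : ℝ}
    (hA : d * (Qo * DN - Qc * DNJ) ≤ m₂ * (dvo * DN - dvc * DNJ))
    (hB : d * (dvbuo * DN - dvbuc * DNJ) ≤ m₁ * (duo * DN - duc * DNJ))
    (hdo : d = dvo + duo + Dof) (hdc : d = dvc + duc + DN)
    (hPo : m₁ = dvbuo + Po) (hPc : m₁ = dvbuc + Pc) (hJ : DNJ ≤ Dof)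
    (hd : 0 ≤ d) (hm₁ : 0 ≤ m₁) (hm₂ : 0 ≤ m₂) (hDN : 0 ≤ DN) (hDNJ : 0 ≤ DNJ)
    (hDNd : DN ≤ d) (hDNJDN : DNJ ≤ DN) :
    DNJ * (m₂ * Pc - m₁ * Qc) ≤ DN * (m₂ * Po - m₁ * Qo) := by
  have key : d * (DN * (m₂ * Po - m₁ * Qo) - DNJ * (m₂ * Pc - m₁ * Qc)) =
      m₁ * (m₂ * (dvo * DN - dvc * DNJ) - d * (Qo * DN - Qc * DNJ)) +
          m₂ * (m₁ * (duo * DN - duc * DNJ) - d * (dvbuo * DN - dvbuc * DNJ)) +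
        m₁ * m₂ * DN * (Dof - DNJ) := by
    linear_combination (-(d * DN * m₂)) * hPo + (d * DNJ * m₂) * hPc + (m₁ * m₂ * DN) * hdo - (m₁ * m₂ * DNJ) * hdc
  have hnonneg : 0 ≤ d * (DN * (m₂ * Po - m₁ * Qo) - DNJ * (m₂ * Pc - m₁ * Qc)) := by
    rw [key]
    have h1 : 0 ≤ m₂ * (dvo * DN - dvc * DNJ) - d * (Qo * DN - Qc * DNJ) := by linarith
    have h2 : 0 ≤ m₁ * (duo * DN - duc * DNJ) - d * (dvbuo * DN - dvbuc * DNJ) := by linarith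
    have h3 : 0 ≤ Dof - DNJ := by linarith
    exact add_nonneg (add_nonneg (mul_nonneg hm₁ h1) (mul_nonneg hm₂ h2))
      (mul_nonneg (mul_nonneg (mul_nonneg hm₁ hm₂) hDN) h3)
  by_cases hd0 : d = 0
  · have hDN0 : DN = 0 := le_antisymm (hd0 ▸ hDNd) hDN
    have hDNJ0 : DNJ = 0 := le_antisymm (hDN0 ▸ hDNJDN) hDNJ
    rw [hDN0, hDNJ0, zero_mul, zero_mul]
  · have hdpos : 0 < d := lt_of_le_of_ne hd (Ne.symm hd0)
    have key' : d * (DNJ * (m₂ * Pc - m₁ * Qc)) ≤ d * (DN * (m₂ * Po - m₁ * Qo)) := by linarith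
    exact le_of_mul_le_mul_left key' hdpos

end PhiOfTD

open PhiOfTD in
/-- **(Φ_D) ⟸ (T_D)** (line `tieline`, lead c14): the registered Phi-transfer stub `stub_phiTransfer_c14`
`μ(D∩N∩J)·(m₂·P_c − m₁·Q_c) ≤ μ(D∩N)·(m₂·P_o − m₁·Q_o)` follows from the all-conditional kernel (T_D) (hypothesis `hTD`,
the registered stub `stub_kernelTD_c13`) applied at `(o, b, u, v, c)` and at `(o, b, v, u, c)`, through the exact identity
`μ(D)·slackΦ = m₁·sTD + m₂·sTD' + m₁·m₂·μ(D∩N)·(μ(D, o free) − μ(D∩N∩J))` and `D∩N∩J ⊆ (D, o free)`.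
[cite: KozmaNitzan2024, Question 7 (p. 36)] -/
theorem phiTransfer_of_TD
    (hTD : ∀ (n : ℕ) (w : Sym2 (Fin n) → unitInterval) (o b u v c : Fin n),
      (prodBernoulli w).real ((openConn u v)ᶜ : Set (BondConfig (Fin n))) *
          ((prodBernoulli w).real ((openConn u v)ᶜ ∩ openConn u b ∩ openConn v o : Set (BondConfig (Fin n))) *
              (prodBernoulli w).real ((openConn u v)ᶜ ∩ ((openConn c u)ᶜ ∩ (openConn c v)ᶜ) : Set (BondConfig (Fin n))) -
            (prodBernoulli w).real ((openConn u v)ᶜ ∩ openConn u b ∩ openConn v c : Set (BondConfig (Fin n))) *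
              (prodBernoulli w).real ((openConn u v)ᶜ ∩ ((openConn c u)ᶜ ∩ (openConn c v)ᶜ) ∩ openConn o c :
                Set (BondConfig (Fin n)))) ≤
        (prodBernoulli w).real ((openConn u v)ᶜ ∩ openConn u b : Set (BondConfig (Fin n))) *
          ((prodBernoulli w).real ((openConn u v)ᶜ ∩ openConn v o : Set (BondConfig (Fin n))) *
              (prodBernoulli w).real ((openConn u v)ᶜ ∩ ((openConn c u)ᶜ ∩ (openConn c v)ᶜ) : Set (BondConfig (Fin n))) -
            (prodBernoulli w).real ((openConn u v)ᶜ ∩ openConn v c : Set (BondConfig (Fin n))) *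
              (prodBernoulli w).real ((openConn u v)ᶜ ∩ ((openConn c u)ᶜ ∩ (openConn c v)ᶜ) ∩ openConn o c :
                Set (BondConfig (Fin n))))) :
    ∀ (n : ℕ) (w : Sym2 (Fin n) → unitInterval) (o b u v c : Fin n), (Literature.Probability.LatticeModels.prodBernoulli w).real ((Literature.Probability.Percolation.openConn u v)ᶜ ∩ ((Literature.Probability.Percolation.openConn c u)ᶜ ∩ (Literature.Probability.Percolation.openConn c v)ᶜ) ∩ Literature.Probability.Percolation.openConn o c : Set (Literature.Probability.Percolation.BondConfig (Fin n))) * ((Literature.Probability.LatticeModels.prodBernoulli w).real ((Literature.Probability.Percolation.openConn u v)ᶜ ∩ Literature.Probability.Percolation.openConn u b : Set (Literature.Probability.Percolation.BondConfig (Fin n))) * (Literature.Probability.LatticeModels.prodBernoulli w).real ((Literature.Probability.Percolation.openConn u v)ᶜ ∩ Literature.Probability.Percolation.openConn v b ∩ (Literature.Probability.Percolation.openConn c u)ᶜ : Set (Literature.Probability.Percolation.BondConfig (Fin n))) - (Literature.Probability.LatticeModels.prodBernoulli w).real ((Literature.Probability.Percolation.openConn u v)ᶜ ∩ Literature.Probability.Percolation.openConn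 v b : Set (Literature.Probability.Percolation.BondConfig (Fin n))) * (Literature.Probability.LatticeModels.prodBernoulli w).real ((Literature.Probability.Percolation.openConn u v)ᶜ ∩ Literature.Probability.Percolation.openConn u b ∩ Literature.Probability.Percolation.openConn v c : Set (Literature.Probability.Percolation.BondConfig (Fin n)))) ≤ (Literature.Probability.LatticeModels.prodBernoulli w).real ((Literature.Probability.Percolation.openConn u v)ᶜ ∩ ((Literature.Probability.Percolation.openConn c u)ᶜ ∩ (Literature.Probability.Percolation.openConn c v)ᶜ) : Set (Literature.Probability.Percolation.BondConfig (Fin n))) * ((Literature.Probability.LatticeModels.prodBernoulli w).real ((Literature.Probability.Percolation.openConn u v)ᶜ ∩ Literature.Probability.Percolation.openConn u b : Set (Literature.Probability.Percolation.BondConfig (Fin n))) * (Literature.Probability.LatticeModels.prodBernoulli w).real ((Literature.Probability.Percolation.openConn u v)ᶜ ∩ Literature.Probability.Percolation.openConn v b ∩ (Literature.Probability.Percolation.openConn o u)ᶜ : Set (Literature.Probability.Percolation.BondConfig (Fin n))) - (Literature.Probability.LatticeModels.prodBernoulli w).real ((Literature.Probability.Percolation.openConn u v)ᶜ ∩ Literature.Probability.Percolation.openConn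 v b : Set (Literature.Probability.Percolation.BondConfig (Fin n))) * (Literature.Probability.LatticeModels.prodBernoulli w).real ((Literature.Probability.Percolation.openConn u v)ᶜ ∩ Literature.Probability.Percolation.openConn u b ∩ Literature.Probability.Percolation.openConn v o : Set (Literature.Probability.Percolation.BondConfig (Fin n)))) := by
  intro n w o b u v c
  have hA := hTD n w o b u v c
  have hB := hTD n w o b v u c
  rw [KNPreFKG.openConn_symm v u,
    Set.inter_comm ((openConn c v)ᶜ : Set (BondConfig (Fin n))) ((openConn c u)ᶜ : Set (BondConfig (Fin n)))] at hB
  have hdo := real_D_split w u v o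
  have hdc := real_D_split w u v c
  rw [D_diff_diff] at hdc
  have hPo := real_Dvb_split w b u v o
  have hPc := real_Dvb_split w b u v c
  have hJ := measureReal_mono (μ := prodBernoulli w) (DNJ_subset o u v c)
  exact alg hA hB hdo hdc hPo hPc hJ measureReal_nonneg measureReal_nonneg measureReal_nonneg measureReal_nonneg
    measureReal_nonneg (measureReal_mono inter_subset_left) (measureReal_mono inter_subset_left)

end

end Summit.CriticalPhenomena.PercolationContinuityZ3.Cruxes.AdditiveGluing.TieLine
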